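import Summits.BirchSwinnertonDyer.BirchSwinnertonDyer.Theorems.ManinLocalTwoThreeManinPrimeToAdditiveFiveLeCornersOfStrongIsUnstarred
import Summits.BirchSwinnertonDyer.BirchSwinnertonDyer.Theorems.ManinLocalTwoThreeManinPrimeToAdditiveFiveLeUnstarredLawOfAcrossIsogeny
import Summits.BirchSwinnertonDyer.Rank1Residual.X2.IsogenyClassStability
import Literature.NumberTheory.EllipticCurves.IsogenyCyclicKernelCoatesProofs
import HarnessLib

/-!
# Route `ManinLocalTwoThree`, residual crux C5 `ManinPrimeToAdditiveFiveLe`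
# (stmt-BirchSwinnertonDyer-22969), line `upper_anchor` (stub `stub_acrossIsogeny57` of skeleton v12 = E-imc-5 at 5, 7;
# `stub_strongIsUnstarred57` of the v13 candidate = K15a): **E-imc-5 `OptimalUnstarredAcrossIsogeny 7` IS K15a
# (stmt-27072) at `p = 7`, and `OptimalUnstarredAcrossIsogeny 5` is K15a plus K15a's missing row `(5; II*)` — by COATES'
# congruence `p·v_q(Δ_min E) ≡ v_q(Δ_min E') (mod 12)`, a PROVED tree theorem (Vélu form); Gealy–Klagsbrun drops out**

Width seat bsd-line-ml23-c5-p1-w2 (gen 5), piece ψ3 (sequel of p633129 `…CornersOfStrongIsUnstarred.lean` and p633601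
`…StrongIsUnstarredOfAcrossIsogeny.lean`). The lead's gen-6 outcome was `promote-stub` on `stub_acrossIsogeny57` (the imc
planner's `@[conjecture]` E-imc-5 at `5` and `7`, not a ledger item); ψ re-socketed its two consumers onto TFMD's item K15a
and showed K15a ⟸ modularity ∧ Gealy–Klagsbrun ∧ E-imc-5(5) ∧ E-imc-5(7). THIS FILE sharpens both directions with the
tree's Coates lemma (`Isogeny.padicValInt_minimalDiscriminantInt_modEq_twelve`, Literature, PROVED from Vélu's formulae):

* §1–§2 `exists_kernel_generator_of_degree_prime` (a prime-degree isogeny has kernel `{k • P : k < p}`, `P` affine of exact order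
  `p`) and `padicValInt_minimalDiscriminantInt_modEq_twelve_of_degree_prime`: **`p·v_q(Δ_min E) ≡ v_q(Δ_min E') (mod 12)`** at
  every prime `q` along a `ℚ`-isogeny of prime degree `p ≥ 5` between globally minimal curves (DD15 Thm. 6, unconditional); at
  `q = p ∈ {5, 7}` this IS the printed dichotomy: potentially ordinary rows keep their type, supersingular rows flip.
* §3, §3b dictionary: `E[p]` reducible off a degree-`p` isogeny (cell X2's lemma re-proved off its cone); additive ⟹ `p² ∣ N`;
  the `p*`-twist of a potentially good additive fibre with `ord_p Δ_min ≠ 6` is additive.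
* §4 `supersingularStrongIsUnstarred_of_acrossIsogeny` — **K15a ⟸ modularity ∧ E-imc-5(5) ∧ E-imc-5(7)**, WITHOUT
  Gealy–Klagsbrun (§2 replaces GK's `δ ≠ δ'` in υ's kernel p626338).
* §5 `acrossIsogeny_starred_rows_of_degree_prime` — the converse core: a degree-`p` isogeny (`p ∈ {5,7}`) from `W` with
  `p² ∣ N(W)` to a globally minimal `W₂` with `ord_p Δ_min(W₂) < 6` forces `ord_p Δ_min(W) < 6` OR `W` on one of the rows
  `(5; 8)`, `(5; 10)`, `(7; 9)` with `W[p]` reducible and `W ⊗ p*` additive (no `Iₙ*` on the target; Coates; Tate's table; §3b).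
* §6 `optimalUnstarredAcrossIsogeny_seven_of_strongIsUnstarred` — **E-imc-5(7) ⟸ K15a** (so, with §4: E-imc-5(7) and
  K15a-at-7 are ONE open statement); `optimalUnstarredAcrossIsogeny_five_of_strongIsUnstarred_of_rowTen` — **E-imc-5(5) ⟸
  K15a ∧ `hII`**, `hII` = K15a's statement on the row `(5; 10)` (the type-II* half of E-imc-5(5); OPEN, not a ledger item,
  NOT needed by the C5 line, whose `(5; 10)` row is Manin-transported to the optimal `χ₅`-partner in p633129).

NET for the planners (-imc, bsd-idea-3): modulo PROVED tree theorems, E-imc-5(7) ⟺ K15a|₇ and E-imc-5(5) ⟺ K15a|₅ ∧ (5; II*)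
— the imc orientation law and TFMD's «SS-Stevens» are the same conjecture up to the single row `(5; II*)`; Gealy–Klagsbrun
2017 is not needed by any of these implications nor by the C5 line. HONEST STATUS: conditional results (`--supports`,
helper); K15a / E-imc-5 / `hII` are OPEN; nothing here proves them, C5, Manin's conjecture or BSD.

References: [DokchitserDokchitser2015LocalInvariants] §2 Thm. 3 (Coates), §3 Thm. 6, Cor. 8; [Velu1971]; [Stevens1989] §2;
[SilvermanAEC2009] III.4.10–4.12, VII.5.1; [SilvermanATAEC1994] IV Table 4.1, IV.10.2(c). -/

set_option autoImplicit false
-- the Theorems namespace of this sub repeats the summit name by design (D-0017 nested layout)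
set_option linter.dupNamespace false

noncomputable section

open scoped Classical NumberField

namespace Summit.BirchSwinnertonDyer.BirchSwinnertonDyer.Theorems

open WeierstrassCurve IsDedekindDomain IsDedekindDomain.HeightOneSpectrum Rat.HeightOneSpectrum NumberField Finset
  Literature.NumberTheory.EllipticCurves Literature.NumberTheory.EllipticCurves.ModularForms
  Literature.NumberTheory.EllipticCurves.Rank1Residual
  Literature.NumberTheory.DiophantineGeometry
  Summit.BirchSwinnertonDyer.Rank1Residual
  Summit.BirchSwinnertonDyer.Rank1Residual.ManinAdditive
  Summit.BirchSwinnertonDyer.Rank1Residual.Additive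

/-! ## §1 An isogeny of prime degree has a cyclic kernel generated by one affine point -/

/-- **The kernel of an isogeny of prime degree `p` is `{k • P : k < p}` for one affine point `P = (x₀, y₀)` of exact
order `p`** (a group of prime order is cyclic, generated by any non-zero element) — the presentation consumed by the
tree's Coates lemma `Isogeny.padicValInt_minimalDiscriminantInt_modEq_twelve`. [cite: SilvermanAEC2009, III.4.10 and III.4.12] -/
theorem exists_kernel_generator_of_degree_prime {W W' : WeierstrassCurve ℚ} [W.IsElliptic] [W'.IsElliptic]
    (φ : Isogeny W W') {p : ℕ} (hp : p.Prime) (hdeg : φ.degree = p) :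
    ∃ (x₀ y₀ : AlgebraicClosure ℚ) (h : (W⁄(AlgebraicClosure ℚ)).toAffine.Nonsingular x₀ y₀),
      (p : ℤ) • Affine.Point.some x₀ y₀ h = 0 ∧
      (∀ k : ℕ, 0 < k → k < p → (k : ℤ) • Affine.Point.some x₀ y₀ h ≠ 0) ∧
      ∀ Q : W.geomPoints, Q ∈ φ.toAddMonoidHom.ker ↔
        Q ∈ (range p).image fun k : ℕ => (k : ℤ) • Affine.Point.some x₀ y₀ h := by
  set A := φ.toAddMonoidHom.ker with hA
  haveI : Finite A := φ.finite_ker'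
  have hcardA : Nat.card A = p := hdeg
  have hnt : 1 < Nat.card A := by rw [hcardA]; exact hp.one_lt
  obtain ⟨P, hP0⟩ : ∃ P : A, P ≠ 0 :=
    haveI := Finite.one_lt_card_iff_nontrivial.mp hnt
    exists_ne 0
  have hord : addOrderOf P = p := by
    rcases (Nat.dvd_prime hp).mp (hcardA ▸ addOrderOf_dvd_natCard P) with h1 | h5
    exacts [absurd (AddMonoid.addOrderOf_eq_one_iff.mp h1) hP0, h5]
  -- `k ↦ k • P`, `k < p`, is a bijection `Fin p → A`
  have hbij : Function.Bijective (fun k : Fin p ↦ (k : ℕ) • P) := by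
    refine Function.Injective.bijective_of_nat_card_le (fun k₁ k₂ hk ↦ ?_) (by simp [hcardA])
    have hmod : (k₁ : ℕ) ≡ k₂ [MOD addOrderOf P] := (nsmul_eq_nsmul_iff_modEq).mp hk
    rw [hord] at hmod
    exact Fin.ext (by
      have h1 := Nat.mod_eq_of_lt k₁.2
      have h2 := Nat.mod_eq_of_lt k₂.2
      unfold Nat.ModEq at hmod
      omega)
  have hpP : (p : ℤ) • (P : W.geomPoints) = 0 := by
    have := addOrderOf_nsmul_eq_zero P
    rw [hord] at this
    rw [natCast_zsmul]
    exact_mod_cast congrArg Subtype.val this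
  have hminP : ∀ k : ℕ, 0 < k → k < p → (k : ℤ) • (P : W.geomPoints) ≠ 0 := by
    intro k hk0 hkp hk
    rw [natCast_zsmul] at hk
    have hk' : k • P = 0 := Subtype.ext (by rw [AddSubmonoidClass.coe_nsmul]; exact hk)
    have hdvd : p ∣ k := hord ▸ addOrderOf_dvd_of_nsmul_eq_zero hk'
    exact absurd (Nat.le_of_dvd hk0 hdvd) (by omega)
  have hkerP : ∀ Q : W.geomPoints, Q ∈ A ↔ ∃ k : ℕ, k < p ∧ (k : ℤ) • (P : W.geomPoints) = Q := by
    intro Q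
    constructor
    · intro hQ
      obtain ⟨k, hk⟩ := hbij.2 ⟨Q, hQ⟩
      refine ⟨k, k.2, ?_⟩
      have := congrArg Subtype.val hk
      rw [natCast_zsmul]
      simpa [AddSubmonoidClass.coe_nsmul] using this
    · rintro ⟨k, -, rfl⟩
      exact A.zsmul_mem P.2 k
  have hPne : (P : W.geomPoints) ≠ 0 := fun h ↦ hP0 (Subtype.ext h)
  -- coordinates of `P`
  obtain ⟨P₀, hP₀A⟩ := P
  simp only at hpP hminP hkerP hPne
  change ((W⁄(AlgebraicClosure ℚ))).toAffine.Point at P₀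
  rcases P₀ with _ | ⟨x₀, y₀, h⟩
  · exact (hPne rfl).elim
  refine ⟨x₀, y₀, h, hpP, hminP, fun Q ↦ (hkerP Q).trans ⟨?_, fun hQ ↦ ?_⟩⟩
  · rintro ⟨k, hk, hkQ⟩
    exact (Finset.mem_image (β := (W⁄(AlgebraicClosure ℚ)).toAffine.Point)).mpr
      ⟨k, Finset.mem_range.mpr hk, hkQ⟩
  · obtain ⟨k, hk, hkQ⟩ := (Finset.mem_image (β := (W⁄(AlgebraicClosure ℚ)).toAffine.Point)).mp hQ
    exact ⟨k, Finset.mem_range.mp hk, hkQ⟩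

/-! ## §2 Coates' congruence for an isogeny of prime degree `p ≥ 5` -/

/-- **`p · v_q(Δ_min E) ≡ v_q(Δ_min E') (mod 12)` at every prime `q`, for globally minimal `E, E'/ℚ` related by a
`ℚ`-isogeny of prime degree `p ≥ 5`** — the tree's Coates lemma (Vélu form, `Isogeny.padicValInt_minimalDiscriminantInt_modEq_twelve`:
Dokchitser–Dokchitser 2015 Thm. 3 / Thm. 6, PROVED) fed with §1. At `q = p` this is the congruence `δ' ≡ pδ (mod 12)` that
decides the Kodaira type across the isogeny: `p ≡ 5`: II ↔ IV*… flips exactly on the tame index `∤ p − 1`.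
[cite: DokchitserDokchitser2015LocalInvariants, §2 Thm. 3 and §3 Thm. 6] -/
theorem padicValInt_minimalDiscriminantInt_modEq_twelve_of_degree_prime {W W' : WeierstrassCurve ℚ} [W.IsElliptic]
    [W'.IsElliptic] [W.IsGloballyMinimal] [W'.IsGloballyMinimal] (φ : Isogeny W W') {p : ℕ} (hp : p.Prime)
    (hp5 : 5 ≤ p) (hdeg : φ.degree = p) (q : ℕ) [Fact q.Prime] :
    (p : ℤ) * padicValInt q W.minimalDiscriminantInt ≡ padicValInt q W'.minimalDiscriminantInt [ZMOD 12] := by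
  obtain ⟨x₀, y₀, h, hn, hmin, hker⟩ := exists_kernel_generator_of_degree_prime φ hp hdeg
  have h2 : ¬ 2 ∣ p := fun h2 ↦ by
    have := (Nat.prime_dvd_prime_iff_eq Nat.prime_two hp).mp h2; omega
  have hnm : p = 2 * (p / 2) + 1 := by omega
  have h3 : Nat.Coprime 3 p := (Nat.coprime_primes Nat.prime_three hp).mpr (by omega)
  exact φ.padicValInt_minimalDiscriminantInt_modEq_twelve h hnm h3 hp.one_lt hn hmin hker q

/-! ## §3 An isogeny of degree `p` makes `E[p]` reducible -/

/-- **`E[p]` is reducible off a `ℚ`-isogeny of degree `p`** (its kernel meets `E[p]` in a Galois-stable line; the kernel is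
not all of `E[p]`, which has `p²` points). The cell `X2`'s lemma (`X2.not_hasIrreducibleModPGaloisRep_of_isogeny_degree_eq`)
re-proved here to keep this module off that import cone. [cite: SilvermanAEC2009, III.4 and III.6.4(b)] -/
theorem not_hasIrreducibleModPGaloisRep_of_isogeny_degree_prime {W W' : WeierstrassCurve ℚ} [W.IsElliptic]
    [W'.IsElliptic] {p : ℕ} [hpF : Fact p.Prime] (φ : Isogeny W W') (hdeg : φ.degree = p) :
    ¬ W.HasIrreducibleModPGaloisRep p := by
  have hp : p.Prime := hpF.out
  have hne : ∃ P : geomPoints W, P ∈ geomTorsion W (p : ℤ) ∧ φ P ≠ 0 := by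
    by_contra h
    push Not at h
    have hle : geomTorsion W (p : ℤ) ≤ φ.toAddMonoidHom.ker := fun P hP ↦ by
      rw [AddMonoidHom.mem_ker]; exact h P hP
    have hcard := AddSubgroup.card_le_of_le hle
    rw [Rank1Residual.natCard_geomTorsion W p] at hcard
    change p ^ 2 ≤ φ.degree at hcard
    rw [hdeg] at hcard
    have : p < p ^ 2 := (pow_one p).symm.trans_lt (Nat.pow_lt_pow_right hp.one_lt (by norm_num))
    omega
  exact not_hasIrreducibleModPGaloisRep_of_isRationalLine
    (GVPeriod.isRationalLine_ker_inf_torsion φ (hdeg ▸ dvd_rfl) hne)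


/-! ## §3b Dictionary: additive ⟹ `p² ∣ N`; the `p*`-twist of a potentially good additive fibre off `I₀*` is additive -/

/-- **Additive at `q` ⟹ `q² ∣ N(W)`** (`f_q ≥ 2`; converse of `not_good_and_not_mult_of_sq_dvd_conductorNorm`).
[cite: SilvermanATAEC1994, IV.10.2(c)] -/
theorem sq_dvd_conductorNorm_of_addv' (W : WeierstrassCurve ℚ) [W.IsElliptic] {q : ℕ} [hqF : Fact q.Prime]
    (h : Addv W q) : q ^ 2 ∣ W.conductorNorm ℤ := by
  have hq : q.Prime := hqF.out
  have hN0 : W.conductorNorm ℤ ≠ 0 := (conductorNorm_pos_holds W).ne'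
  rw [hq.pow_dvd_iff_le_factorization hN0, factorization_conductorNorm_primesEquiv_symm W ⟨q, hq⟩]
  by_contra hlt
  have hf : W.conductorExponent ((primesEquiv (R := ℤ)).symm ⟨q, hq⟩) = 0 ∨
      W.conductorExponent ((primesEquiv (R := ℤ)).symm ⟨q, hq⟩) = 1 := by omega
  rcases hf with h0 | h1
  · exact h.1 ((W.hasGoodReductionAtPrime_iff_hasGoodReductionAt_holds ⟨q, hq⟩).mpr
      ((conductorExponent_eq_zero_iff_holds _ W).mp h0))
  · exact h.2 ((W.hasMultiplicativeReductionAtPrime_iff_hasMultiplicativeReductionAt_holds ⟨q, hq⟩).mpr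
      ((conductorExponent_eq_one_iff_holds _ W).mp h1))

/-- **The `χ_{p*}`-twist of a potentially good additive fibre with `ord_p Δ_min ≠ 6` is additive at `p`** (neither good
nor multiplicative at the place `(p)`): a globally minimal model `C` of `W ⊗ p*` has `ord_p Δ_min(C) ≡ ord_p Δ_min(W) + 6
(mod 12)` (`padicValInt_minimalDiscriminantInt_twist_pStar_eq`), not `0` since `ord_p Δ_min(W) ≠ 6`, and `ord_p j(C) =
ord_p j(W) ≥ 0`; so `C` is additive, `p² ∣ N(C) = N(W ⊗ p*)`. [cite: SilvermanATAEC1994, IV Table 4.1] [cite: SilvermanAEC2009, VII.5 Prop. 5.1] -/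
theorem twist_pStar_not_semistable_of_padicValRat_j_nonneg_of_ne_six (W : WeierstrassCurve ℚ) [W.IsElliptic]
    [W.IsGloballyMinimal] (p : ℕ) [hpF : Fact p.Prime] (hp5 : 5 ≤ p) (hadd : Addv W p)
    (hj : 0 ≤ padicValRat p W.j) (h6 : padicValInt p W.minimalDiscriminantInt ≠ 6) :
    ¬ ((W.quadraticTwist (((-1 : ℤ) ^ (p / 2) * p : ℤ) : ℚ)).HasGoodReductionAt
          ((Rat.HeightOneSpectrum.primesEquiv (R := ℤ)).symm ⟨p, hpF.out⟩) ∨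
        (W.quadraticTwist (((-1 : ℤ) ^ (p / 2) * p : ℤ) : ℚ)).HasMultiplicativeReductionAt
          ((Rat.HeightOneSpectrum.primesEquiv (R := ℤ)).symm ⟨p, hpF.out⟩)) := by
  have hp : p.Prime := hpF.out
  obtain ⟨hcast, -⟩ := pStar_intCast p
  have hd0 : ((((-1 : ℤ) ^ (p / 2) * p : ℤ)) : ℚ) ≠ 0 := by
    push_cast
    exact mul_ne_zero (pow_ne_zero _ (by norm_num)) (by exact_mod_cast hp.ne_zero)
  set T : WeierstrassCurve ℚ := W.quadraticTwist ((((-1 : ℤ) ^ (p / 2) * p : ℤ)) : ℚ) with hT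
  haveI hTe : T.IsElliptic := W.isElliptic_quadraticTwist hd0
  obtain ⟨u, hCmin⟩ := hasGlobalMinimalModel_rat_holds T
  set C : WeierstrassCurve ℚ := u • T with hCdef
  haveI : C.IsGloballyMinimal := hCmin
  have hvC : (padicValInt p C.minimalDiscriminantInt : ℤ) =
      padicValInt p W.minimalDiscriminantInt + 6 - 12 * padicValRat p (u.u : ℚ) :=
    padicValInt_minimalDiscriminantInt_twist_pStar_eq p W C u (by rw [← hcast])
  obtain ⟨m, hm⟩ : ∃ m : ℤ, padicValRat p (u.u : ℚ) = m := ⟨_, rfl⟩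
  rw [hm] at hvC
  have hmem := padicValInt_minimalDiscriminantInt_mem_of_addv_of_padicValRat_j_nonneg W p hp5 hadd hj
  have hjC : 0 ≤ padicValRat p C.j := by
    rw [j_eq_of_smul_quadraticTwist_eq hd0 u hCdef.symm]; exact hj
  have hngood : ¬ Good C p := by
    intro hgood
    have h0 : padicValInt p C.minimalDiscriminantInt = 0 :=
      padicValInt.eq_zero_of_not_dvd (EisensteinPrimes.not_dvd_disc_of_good C p hgood)
    rw [h0] at hvC
    rcases hmem with h | h | h | h | h | h | h <;> rw [h] at hvC h6 <;> omega
  have hnmult : ¬ Mult C p := fun hmult ↦ not_lt.mpr hjC (EisensteinPrimes.padicValRat_j_neg_of_mult C p hmult)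
  have hsq' : p ^ 2 ∣ C.conductorNorm ℤ := sq_dvd_conductorNorm_of_addv' C ⟨hngood, hnmult⟩
  have hsq : p ^ 2 ∣ T.conductorNorm ℤ := by rwa [hCdef, conductorNorm_smul] at hsq'
  obtain ⟨hng, hnm⟩ := not_good_and_not_mult_of_sq_dvd_conductorNorm T hsq
  rintro (hg | hmu)
  · exact hng ((T.hasGoodReductionAtPrime_iff_hasGoodReductionAt_holds ⟨p, hp⟩).mpr hg)
  · exact hnm ((T.hasMultiplicativeReductionAtPrime_iff_hasMultiplicativeReductionAt_holds ⟨p, hp⟩).mpr hmu)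

/-! ## §4 K15a ⟸ modularity ∧ E-imc-5(5) ∧ E-imc-5(7) — Gealy–Klagsbrun NOT needed -/

/-- **K15a `TwistFamilyManinDescent.SupersingularStrongIsUnstarred` (stmt-27072) BY NAME ⟸ modularity ∧ E-imc-5
`OptimalUnstarredAcrossIsogeny` at `5` and at `7`** — the Gealy–Klagsbrun-free form of
`supersingularStrongIsUnstarred_of_acrossIsogeny_of_gealyKlagsbrun` (p633601): on K15a's starred rows `(5; 8)`, `(7; 9)`
the rational `p`-isogeny `W → W₂` given by reducibility (globally minimal target) has `ord_p Δ_min(W₂) ≡ 8·5, 9·7 ≡ 4, 3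
(mod 12)` by Coates' congruence (§2), so `ord_p Δ_min(W₂) ∈ {4, 3} < 6` (Tate's table for the additive potentially good
`W₂`), and E-imc-5 forbids the lattice-optimal `W` to be the starred end. Conditional result; closes nothing.
[cite: DokchitserDokchitser2015LocalInvariants, §3 Thm. 6] [cite: Stevens1989, §2] [cite: SilvermanATAEC1994, IV Table 4.1] -/
theorem supersingularStrongIsUnstarred_of_acrossIsogeny (hnf : exists_isNewformOf)
    (hE5 : OptimalUnstarredAcrossIsogeny 5) (hE7 : OptimalUnstarredAcrossIsogeny 7) :
    Summit.BirchSwinnertonDyer.BirchSwinnertonDyer.Theses.TwistFamilyManinDescent.SupersingularStrongIsUnstarred := by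
  intro W _ _ N _ D p hp hrow hpN hred htw hD
  haveI hpF : Fact p.Prime := ⟨hp⟩
  obtain rfl : N = W.conductorNorm ℤ := IsNewformOf.level_eq_conductorNorm_of_exists_isNewformOf hnf D.isNewformOf
  have h57 : p = 5 ∨ p = 7 := by
    rcases hrow with ⟨h, -⟩ | ⟨h, -⟩
    exacts [Or.inl h, Or.inr h]
  have hp5 : 5 ≤ p := by rcases h57 with rfl | rfl <;> norm_num
  have hp2 : p ≠ 2 := by omega
  have hadd : Addv W p := not_good_and_not_mult_of_sq_dvd_conductorNorm W hpN
  have hj : 0 ≤ padicValRat p W.j := padicValRat_j_nonneg_of_addv_of_twist_pStar_not_semistable W p hp2 hadd htw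
  have hrow' : padicValInt p W.minimalDiscriminantInt < 6 ∨
      (p = 5 ∧ padicValInt p W.minimalDiscriminantInt = 8) ∨ (p = 7 ∧ padicValInt p W.minimalDiscriminantInt = 9) := by
    rcases hrow with ⟨rfl, h⟩ | ⟨rfl, h⟩ <;>
      simp only [Finset.mem_insert, Finset.mem_singleton] at h <;> omega
  rcases hrow' with h | hstar
  · exact h
  exfalso
  -- the rational `p`-isogeny given by reducibility, with a globally minimal target
  obtain ⟨W', hE', φ, -, hdeg, -, -⟩ :=
    Summit.BirchSwinnertonDyer.Rank1Residual.LW16.IsogenyEdge.exists_isogeny_comp_eq_prime_smul_of_not_irreducible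
      W hred
  haveI := hE'
  obtain ⟨C, hCmin⟩ := hasGlobalMinimalModel_rat_holds W'
  haveI : (C • W').IsGloballyMinimal := hCmin
  set φ₂ : Isogeny W (C • W') := (VariableChange.toIsogeny W' C).comp φ with hφ₂
  have hdeg₂ : φ₂.degree = p := by
    rw [← hdeg]
    unfold Isogeny.degree
    rw [hφ₂, Isogeny.ker_comp, VariableChange.ker_toIsogeny, AddMonoidHom.comap_bot]
  obtain ⟨hadd₂, hj₂⟩ := Addv.of_isIsogenous_of_padicValRat_j_nonneg (p := p) hadd hj ⟨φ₂⟩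
  have hmem₂ := padicValInt_minimalDiscriminantInt_mem_of_addv_of_padicValRat_j_nonneg (C • W') p hp5 hadd₂ hj₂
  -- Coates: `p · ord_p Δ_min(W) ≡ ord_p Δ_min(W₂) (mod 12)`
  have hmod := padicValInt_minimalDiscriminantInt_modEq_twelve_of_degree_prime φ₂ hp hp5 hdeg₂ p
  rw [Int.modEq_iff_dvd] at hmod
  have hv₂ : padicValInt p (C • W').minimalDiscriminantInt < 6 := by
    rcases hstar with ⟨rfl, h⟩ | ⟨rfl, h⟩ <;> rw [h] at hmod <;>
      rcases hmem₂ with h' | h' | h' | h' | h' | h' | h' <;> rw [h'] at hmod ⊢ <;> omega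
  have hE : OptimalUnstarredAcrossIsogeny p := by
    rcases h57 with rfl | rfl
    exacts [hE5, hE7]
  have h6 := hE W (C • W') D φ₂ hp hp5 hD hpN hdeg₂ hv₂
  rcases hstar with ⟨-, h⟩ | ⟨-, h⟩ <;> omega

/-! ## §5 The converse direction: what a degree-`p` isogeny out of a curve with `6 ≤ ord_p Δ_min` looks like at `p ∈ {5, 7}` -/

/-- **Core of the converse.** `W, W₂/ℚ` globally minimal, `φ : W → W₂` of prime degree `p ∈ {5, 7}`, `p² ∣ N(W)`,
`ord_p Δ_min(W₂) < 6`: EITHER `ord_p Δ_min(W) < 6`, OR `W` sits on one of the three potentially supersingular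
starred rows `(5; 8)`, `(5; 10)`, `(7; 9)`, `W[p]` is reducible and `W ⊗ p*` is additive at `p`. Proof: `W₂` is additive
(isogeny invariance) with `ord_p Δ_min < 6`, so it has no `Iₙ*` fibre and is potentially good; hence so is `W`
(`0 ≤ ord_p j`); Coates' congruence `p·ord_p Δ_min(W) ≡ ord_p Δ_min(W₂) (mod 12)` (§2) with both valuations in Tate's
list `{2,3,4,6,8,9,10}` leaves exactly the rows `8·5 ≡ 4`, `10·5 ≡ 2`, `9·7 ≡ 3`; reducibility is §3; the twist is additive
by §3b.
[cite: DokchitserDokchitser2015LocalInvariants, §3 Thm. 6 and Cor. 8] [cite: SilvermanATAEC1994, IV Table 4.1] -/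
theorem acrossIsogeny_starred_rows_of_degree_prime {p : ℕ} (h57 : p = 5 ∨ p = 7)
    (W W₂ : WeierstrassCurve ℚ) [W.IsElliptic] [W.IsGloballyMinimal] [W₂.IsElliptic] [W₂.IsGloballyMinimal]
    (φ : Isogeny W W₂) (hp : p.Prime) (hpN : p ^ 2 ∣ W.conductorNorm ℤ) (hdeg : φ.degree = p)
    (hv₂ : padicValInt p W₂.minimalDiscriminantInt < 6) :
    padicValInt p W.minimalDiscriminantInt < 6 ∨
      (((p = 5 ∧ padicValInt p W.minimalDiscriminantInt = 8) ∨ (p = 5 ∧ padicValInt p W.minimalDiscriminantInt = 10) ∨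
          (p = 7 ∧ padicValInt p W.minimalDiscriminantInt = 9)) ∧
        ¬ W.HasIrreducibleModPGaloisRep p ∧
        ¬ ((W.quadraticTwist (((-1 : ℤ) ^ (p / 2) * p : ℤ) : ℚ)).HasGoodReductionAt
              ((Rat.HeightOneSpectrum.primesEquiv (R := ℤ)).symm ⟨p, hp⟩) ∨
            (W.quadraticTwist (((-1 : ℤ) ^ (p / 2) * p : ℤ) : ℚ)).HasMultiplicativeReductionAt
              ((Rat.HeightOneSpectrum.primesEquiv (R := ℤ)).symm ⟨p, hp⟩))) := by
  haveI hpF : Fact p.Prime := ⟨hp⟩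
  have hp5 : 5 ≤ p := by rcases h57 with rfl | rfl <;> norm_num
  have hp2 : p ≠ 2 := by omega
  have hadd : Addv W p := not_good_and_not_mult_of_sq_dvd_conductorNorm W hpN
  have hiso : IsIsogenous W W₂ := ⟨φ⟩
  have hadd₂ : Addv W₂ p := (Summit.BirchSwinnertonDyer.Rank1Residual.X2.addv_iff_of_isIsogenous hiso).mp hadd
  -- `W₂` has no `Iₙ*` fibre (`ord_p Δ_min < 6`), so `0 ≤ ord_p j(W₂)` and `0 ≤ ord_p j(W)`
  have hI₂ : ∀ n : ℕ, W₂.kodairaSymbolAt (placeOf p) ≠ .Istar n := by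
    intro n hK
    rcases kodairaSymbolAt_placeOf_cases_of_addv W₂ p hp5 hadd₂ with
      ⟨h, -⟩ | ⟨h, -⟩ | ⟨h, -⟩ | ⟨m, -, hv⟩ | ⟨h, -⟩ | ⟨h, -⟩ | ⟨h, -⟩
    all_goals first | omega | (rw [hK] at h; cases h)
  have hj₂ : 0 ≤ padicValRat p W₂.j := by
    refine MemberManinUnitFiveSevenGlue.padicValRat_j_nonneg_of_forall_ne_Istar W₂ hp2 hadd₂ ?_
    intro v n hv' hK
    have hvv : v = placeOf p := (primesEquiv (R := ℤ)).injective
      (Subtype.ext (hv'.trans (natGenerator_placeOf_eq p).symm))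
    subst hvv
    exact hI₂ n hK
  obtain ⟨-, hj⟩ := Addv.of_isIsogenous_of_padicValRat_j_nonneg (p := p) hadd₂ hj₂ hiso.symm_of_charZero
  have hmem := padicValInt_minimalDiscriminantInt_mem_of_addv_of_padicValRat_j_nonneg W p hp5 hadd hj
  have hmem₂ := padicValInt_minimalDiscriminantInt_mem_of_addv_of_padicValRat_j_nonneg W₂ p hp5 hadd₂ hj₂
  by_cases hv : padicValInt p W.minimalDiscriminantInt < 6
  · exact Or.inl hv
  right
  -- Coates' congruence singles out the three flip rows
  have hmod := padicValInt_minimalDiscriminantInt_modEq_twelve_of_degree_prime φ hp hp5 hdeg p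
  rw [Int.modEq_iff_dvd] at hmod
  have hrow : (p = 5 ∧ padicValInt p W.minimalDiscriminantInt = 8) ∨ (p = 5 ∧ padicValInt p W.minimalDiscriminantInt = 10) ∨
      (p = 7 ∧ padicValInt p W.minimalDiscriminantInt = 9) := by
    rcases h57 with rfl | rfl <;>
      rcases hmem with h | h | h | h | h | h | h <;> rw [h] at hmod hv ⊢ <;>
        rcases hmem₂ with h' | h' | h' | h' | h' | h' | h' <;> rw [h'] at hmod hv₂ <;> omega
  have h6 : padicValInt p W.minimalDiscriminantInt ≠ 6 := by
    rcases hrow with ⟨-, h⟩ | ⟨-, h⟩ | ⟨-, h⟩ <;> omega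
  exact ⟨hrow, not_hasIrreducibleModPGaloisRep_of_isogeny_degree_prime φ hdeg,
    twist_pStar_not_semistable_of_padicValRat_j_nonneg_of_ne_six W p hp5 hadd hj h6⟩

/-! ## §6 E-imc-5(7) ⟸ K15a; E-imc-5(5) ⟸ K15a ∧ K15a's missing row `(5; II*)` -/

/-- **E-imc-5 at `7` IS (a corollary of) K15a**: `OptimalUnstarredAcrossIsogeny 7 ⟸
TwistFamilyManinDescent.SupersingularStrongIsUnstarred` (stmt-27072). With §4 (and modularity) the two are EQUIVALENT on
their common ground: the imc planner's within-class orientation law at `7` and bsd-idea-3's «SS-Stevens at 7» are ONE open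
statement. By §5 the only starred row a `7`-isogeny with unstarred target can start from is `(7; 9)` — a K15a row, with
the reducibility and twist-additivity K15a asks for. Conditional result; closes nothing.
[cite: Stevens1989, §2] [cite: DokchitserDokchitser2015LocalInvariants, §3 Cor. 8] -/
theorem optimalUnstarredAcrossIsogeny_seven_of_strongIsUnstarred
    (hSU : Summit.BirchSwinnertonDyer.BirchSwinnertonDyer.Theses.TwistFamilyManinDescent.SupersingularStrongIsUnstarred) :
    OptimalUnstarredAcrossIsogeny 7 := by
  intro W W₂ _ _ _ _ _ D φ hp hp5 hD hpN hdeg hv₂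
  rcases acrossIsogeny_starred_rows_of_degree_prime (Or.inr rfl) W W₂ φ hp hpN hdeg hv₂ with
    h | ⟨hrow, hred, htw⟩
  · exact h
  rcases hrow with ⟨h, -⟩ | ⟨h, -⟩ | ⟨-, h9⟩
  · norm_num at h
  · norm_num at h
  exact hSU W D 7 hp (Or.inr ⟨rfl, by simp [h9]⟩) hpN hred htw hD

/-- **E-imc-5 at `5` ⟸ K15a ∧ ITS MISSING ROW `(5; II*)`**: `OptimalUnstarredAcrossIsogeny 5 ⟸
TwistFamilyManinDescent.SupersingularStrongIsUnstarred` (stmt-27072, rows `(5; 4/8)`) ∧ `hII` = the SAME statement on the row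
`(5; 10)` («a lattice-optimal `W` with `ord₅ Δ_min = 10`, `25 ∣ N`, `W[5]` reducible, `W ⊗ 5` additive at `5` does not
exist», stated as `ord₅ Δ_min < 6`; OPEN, not a ledger item: it is the type-II* half of E-imc-5(5), census 0 / 255 II–II*
pairs `N < 10⁵`; the C5 line does NOT need it — there Manin's `5 ∤ c` on `(5; 10)` comes from the optimal `χ₅`-partner,
`coreRED57starred_of_twistFamilyItems`, p633129). By §5 the starred rows a `5`-isogeny with unstarred target can start from
are `(5; 8)` (K15a) and `(5; 10)` (`hII`). Conditional result; closes nothing.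
[cite: Stevens1989, §2] [cite: DokchitserDokchitser2015LocalInvariants, §3 Cor. 8] -/
theorem optimalUnstarredAcrossIsogeny_five_of_strongIsUnstarred_of_rowTen
    (hSU : Summit.BirchSwinnertonDyer.BirchSwinnertonDyer.Theses.TwistFamilyManinDescent.SupersingularStrongIsUnstarred)
    (hII : ∀ (W : WeierstrassCurve ℚ) [W.IsElliptic] [W.IsGloballyMinimal] {N : ℕ} [NeZero N]
      (D : ModularParametrizationData W N) (hp : (5 : ℕ).Prime),
      padicValInt 5 W.minimalDiscriminantInt = 10 → 5 ^ 2 ∣ N → ¬ W.HasIrreducibleModPGaloisRep 5 →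
      ¬ ((W.quadraticTwist (((-1 : ℤ) ^ (5 / 2) * 5 : ℤ) : ℚ)).HasGoodReductionAt
            ((Rat.HeightOneSpectrum.primesEquiv (R := ℤ)).symm ⟨5, hp⟩) ∨
          (W.quadraticTwist (((-1 : ℤ) ^ (5 / 2) * 5 : ℤ) : ℚ)).HasMultiplicativeReductionAt
            ((Rat.HeightOneSpectrum.primesEquiv (R := ℤ)).symm ⟨5, hp⟩)) →
      (∀ z ∈ D.L.lattice, ∃ w ∈ periodLattice D.f, z = D.c * w) →
      padicValInt 5 W.minimalDiscriminantInt < 6) :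
    OptimalUnstarredAcrossIsogeny 5 := by
  intro W W₂ _ _ _ _ _ D φ hp hp5 hD hpN hdeg hv₂
  rcases acrossIsogeny_starred_rows_of_degree_prime (Or.inl rfl) W W₂ φ hp hpN hdeg hv₂ with
    h | ⟨hrow, hred, htw⟩
  · exact h
  rcases hrow with ⟨-, h8⟩ | ⟨-, h10⟩ | ⟨h, -⟩
  · exact hSU W D 5 hp (Or.inl ⟨rfl, by simp [h8]⟩) hpN hred htw hD
  · exact hII W D hp h10 hpN hred htw hD
  · norm_num at h

end Summit.BirchSwinnertonDyer.BirchSwinnertonDyer.Theorems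

end
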